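import Summits.Ventures.DiscreteObjects.PP12.AffineSTD

/-!
# Coordinates in the affine STD₁[n;n] of a flag, and the label action of a collineation with centre `c` and axis `l` (kernel)
Framing: lottery ticket; floor = certified bounds/negative ranges.

Cell pub-namedobj (venture DiscreteObjects), target (M), designs gen 9.  Continuation of `AffineSTD.lean`: `fP`, `fL` are
the coordinates (class, label) of a point off `l` / a line avoiding `c` (`ptOf_fP`, `fP_ptOf`, `blkOf_fL`, `fL_blkOf`;
incidence in coordinates `mem_iff_affArr`).  A collineation `σ` of a finite projective plane with axis `l` and centre
`c ∈ l` fixes every point class (line through `c`) and every block class (point of `l`) of the affine array `affArr hcl`,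
so it acts on the labels of each class:
`labelPermP σ i`, `labelPermL σ j` with `ptOf i (labelPermP σ i a) = σ (ptOf i a)`, `blkOf j (labelPermL σ j b) =
σ (blkOf j b)`; the action transports incidence (`affArr_labelPerm` — a class-fixing automorphism of the array in the
sense of `STD.ClassRegularQuotient`), has order dividing that of `σ` (`labelPermP_pow`), is fixed-point-free when `σ ≠ 1`
is an elation (`labelPermP_ne`), and describes the coordinates of image points (`fP_map`, `fL_map`).  Classical;
formalisation ours; no `sorry`.
-/

namespace Summit.Ventures.DiscreteObjects.PP12

open Configuration Finset Summit.Ventures.DiscreteObjects.STD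
open scoped Classical

section Action

variable {P L : Type*} [Membership P L] [ProjectivePlane P L] [Fintype P] [Fintype L] {c : P} {l : L}
  (hcl : c ∈ l)
include hcl

/-! ### Coordinates of points off `l` and of lines avoiding `c` -/

omit [ProjectivePlane P L] [Fintype P] [Fintype L] hcl in
/-- `c ≠ x` for `x ∉ l` (given `c ∈ l`) -/
theorem ne_of_not_mem (hcl : c ∈ l) {x : P} (hx : x ∉ l) : c ≠ x := fun h => hx (h ▸ hcl)

/-- the coordinates (class, label) of a point off `l` -/
noncomputable def fP (x : {x : P // x ∉ l}) : Fin (ProjectivePlane.order P L) × Fin (ProjectivePlane.order P L) :=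
  let hX : c ∈ (HasLines.mkLine (ne_of_not_mem hcl x.2) : L) ∧ (HasLines.mkLine (ne_of_not_mem hcl x.2) : L) ≠ l :=
    ⟨(HasLines.mkLine_ax (ne_of_not_mem hcl x.2)).1, fun h => x.2 (by
      have hm : x.1 ∈ (HasLines.mkLine (ne_of_not_mem hcl x.2) : L) := (HasLines.mkLine_ax (ne_of_not_mem hcl x.2)).2
      rw [h] at hm; exact hm)⟩
  (idxOf hcl _ hX, labOf hcl (idxOf hcl _ hX) x.1
    (by rw [lineOf_idxOf]; exact ⟨(HasLines.mkLine_ax (ne_of_not_mem hcl x.2)).2, (ne_of_not_mem hcl x.2).symm⟩))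

/-- `fP` are coordinates: the point with coordinates `fP x` is `x` -/
@[simp] theorem ptOf_fP (x : {x : P // x ∉ l}) : ptOf hcl (fP hcl x).1 (fP hcl x).2 = x.1 := by
  simp only [fP, ptOf_labOf]

/-- the coordinates of `ptOf i a` are `(i, a)` -/
theorem fP_ptOf (i a : Fin (ProjectivePlane.order P L)) : fP hcl ⟨ptOf hcl i a, ptOf_not_mem hcl i a⟩ = (i, a) := by
  obtain ⟨h1, h2⟩ := ptOf_injective hcl (ptOf_fP hcl ⟨ptOf hcl i a, ptOf_not_mem hcl i a⟩)
  exact Prod.ext h1 h2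

/-- `fP` is injective -/
theorem fP_injective : Function.Injective (fP (P := P) hcl) := by
  intro x y h
  apply Subtype.ext
  rw [← ptOf_fP hcl x, ← ptOf_fP hcl y, h]

/-- `fP` is surjective -/
theorem fP_surjective : Function.Surjective (fP (P := P) hcl) :=
  fun ia => ⟨⟨ptOf hcl ia.1 ia.2, ptOf_not_mem hcl ia.1 ia.2⟩, fP_ptOf hcl ia.1 ia.2⟩

omit [ProjectivePlane P L] [Fintype P] [Fintype L] hcl in
/-- a line avoiding `c` is not `l` -/
theorem ne_of_center_not_mem (hcl : c ∈ l) {m : L} (hm : c ∉ m) : m ≠ l := fun h => hm (h ▸ hcl)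

/-- the coordinates (class, label) of a line avoiding `c` -/
noncomputable def fL (m : {m : L // c ∉ m}) : Fin (ProjectivePlane.order P L) × Fin (ProjectivePlane.order P L) :=
  let hu : (HasPoints.mkPoint (ne_of_center_not_mem hcl m.2) : P) ∈ l ∧
      (HasPoints.mkPoint (ne_of_center_not_mem hcl m.2) : P) ≠ c :=
    ⟨(HasPoints.mkPoint_ax (ne_of_center_not_mem hcl m.2)).2, fun h => m.2 (by
      have hm : (HasPoints.mkPoint (ne_of_center_not_mem hcl m.2) : P) ∈ m.1 :=
        (HasPoints.mkPoint_ax (ne_of_center_not_mem hcl m.2)).1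
      rw [h] at hm; exact hm)⟩
  (bidxOf hcl _ hu, blabOf hcl (bidxOf hcl _ hu) m.1
    (by rw [bptOf_bidxOf]; exact ⟨(HasPoints.mkPoint_ax (ne_of_center_not_mem hcl m.2)).1, ne_of_center_not_mem hcl m.2⟩))

/-- `fL` are coordinates: the line with coordinates `fL m` is `m` -/
@[simp] theorem blkOf_fL (m : {m : L // c ∉ m}) : blkOf hcl (fL hcl m).1 (fL hcl m).2 = m.1 := by
  simp only [fL, blkOf_blabOf]

/-- the coordinates of `blkOf j b` are `(j, b)` -/
theorem fL_blkOf (j b : Fin (ProjectivePlane.order P L)) :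
    fL hcl ⟨blkOf hcl j b, center_not_mem_blkOf hcl j b⟩ = (j, b) := by
  obtain ⟨h1, h2⟩ := blkOf_injective hcl (blkOf_fL hcl ⟨blkOf hcl j b, center_not_mem_blkOf hcl j b⟩)
  exact Prod.ext h1 h2

/-- `fL` is injective -/
theorem fL_injective : Function.Injective (fL (L := L) hcl) := by
  intro m m' h
  apply Subtype.ext
  rw [← blkOf_fL hcl m, ← blkOf_fL hcl m', h]

/-- `fL` is surjective -/
theorem fL_surjective : Function.Surjective (fL (L := L) hcl) :=
  fun jb => ⟨⟨blkOf hcl jb.1 jb.2, center_not_mem_blkOf hcl jb.1 jb.2⟩, fL_blkOf hcl jb.1 jb.2⟩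

/-- **Incidence in coordinates.** `x ∈ m ↔ affArr (fP x).1 (fL m).1 (fP x).2 = (fL m).2`. -/
theorem mem_iff_affArr (x : {x : P // x ∉ l}) (m : {m : L // c ∉ m}) :
    x.1 ∈ m.1 ↔ affArr hcl (fP hcl x).1 (fL hcl m).1 (fP hcl x).2 = (fL hcl m).2 := by
  rw [affArr_apply_eq_iff hcl, ptOf_fP, blkOf_fL]


/-! ### A collineation with centre `c` and axis `l` acts on the labels of every class -/

variable (σ : Collineation P L)

/-- `σ` maps the points of class `i` to points of class `i` -/
theorem map_ptOf_mem (hl : σ.IsAxis l) (hc : σ.IsCenter c) (i a : Fin (ProjectivePlane.order P L)) :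
    σ.onPoints (ptOf hcl i a) ∈ lineOf hcl i ∧ σ.onPoints (ptOf hcl i a) ≠ c := by
  refine ⟨?_, fun h => ptOf_ne hcl i a (σ.onPoints.injective (h.trans (σ.center_fixed hl hc).symm))⟩
  have h := σ.mem_map (ptOf_mem hcl i a)
  rwa [hc _ (mem_lineOf hcl i)] at h

/-- `σ` maps the blocks of class `j` to blocks of class `j` -/
theorem map_blkOf_mem (hl : σ.IsAxis l) (j b : Fin (ProjectivePlane.order P L)) :
    bptOf hcl j ∈ σ.onLines (blkOf hcl j b) ∧ σ.onLines (blkOf hcl j b) ≠ l := by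
  refine ⟨?_, fun h => blkOf_ne hcl j b (σ.onLines.injective (h.trans (σ.axis_fixed hl).symm))⟩
  have h := σ.mem_map (bptOf_mem_blkOf hcl j b)
  rwa [hl _ (bptOf_mem hcl j)] at h

/-- the action of `σ` on the labels of point class `i`, as a function -/
noncomputable def labelMapP (hl : σ.IsAxis l) (hc : σ.IsCenter c) (i : Fin (ProjectivePlane.order P L)) (a : Fin (ProjectivePlane.order P L)) :
    Fin (ProjectivePlane.order P L) :=
  labOf hcl i (σ.onPoints (ptOf hcl i a)) (map_ptOf_mem hcl σ hl hc i a)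

/-- `ptOf i (labelMapP i a) = σ (ptOf i a)` -/
theorem ptOf_labelMapP (hl : σ.IsAxis l) (hc : σ.IsCenter c) (i a : Fin (ProjectivePlane.order P L)) :
    ptOf hcl i (labelMapP hcl σ hl hc i a) = σ.onPoints (ptOf hcl i a) := by
  simp only [labelMapP, ptOf_labOf]

/-- the label action is a bijection -/
theorem labelMapP_bijective (hl : σ.IsAxis l) (hc : σ.IsCenter c) (i : Fin (ProjectivePlane.order P L)) : Function.Bijective (labelMapP hcl σ hl hc i) := by
  rw [← Finite.injective_iff_bijective]
  intro a a' h
  apply ptOf_inj_right hcl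
  apply σ.onPoints.injective
  rw [← ptOf_labelMapP hcl σ hl hc, ← ptOf_labelMapP hcl σ hl hc, h]

/-- **The action of `σ` on the labels of point class `i`.** -/
noncomputable def labelPermP (hl : σ.IsAxis l) (hc : σ.IsCenter c) (i : Fin (ProjectivePlane.order P L)) : Equiv.Perm (Fin (ProjectivePlane.order P L)) :=
  Equiv.ofBijective (labelMapP hcl σ hl hc i) (labelMapP_bijective hcl σ hl hc i)

/-- `ptOf i (labelPermP i a) = σ (ptOf i a)` -/
theorem ptOf_labelPermP (hl : σ.IsAxis l) (hc : σ.IsCenter c) (i a : Fin (ProjectivePlane.order P L)) :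
    ptOf hcl i (labelPermP hcl σ hl hc i a) = σ.onPoints (ptOf hcl i a) := by
  unfold labelPermP; rw [Equiv.ofBijective_apply]; exact ptOf_labelMapP hcl σ hl hc i a

/-- iterates: `ptOf i ((labelPermP i)^t a) = σ^t (ptOf i a)` -/
theorem ptOf_labelPermP_pow (hl : σ.IsAxis l) (hc : σ.IsCenter c) (i : Fin (ProjectivePlane.order P L)) (t : ℕ) (a : Fin (ProjectivePlane.order P L)) :
    ptOf hcl i ((labelPermP hcl σ hl hc i ^ t) a) = (σ.onPoints ^ t) (ptOf hcl i a) := by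
  induction t generalizing a with
  | zero => simp
  | succ t ih => rw [pow_succ, Equiv.Perm.mul_apply, ih, ptOf_labelPermP, ← Equiv.Perm.mul_apply, ← pow_succ]

/-- the action of `σ` on the labels of block class `j`, as a function -/
noncomputable def labelMapL (hl : σ.IsAxis l) (j : Fin (ProjectivePlane.order P L)) (b : Fin (ProjectivePlane.order P L)) :
    Fin (ProjectivePlane.order P L) :=
  blabOf hcl j (σ.onLines (blkOf hcl j b)) (map_blkOf_mem hcl σ hl j b)

/-- `blkOf j (labelMapL j b) = σ (blkOf j b)` -/
theorem blkOf_labelMapL (hl : σ.IsAxis l) (j b : Fin (ProjectivePlane.order P L)) :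
    blkOf hcl j (labelMapL hcl σ hl j b) = σ.onLines (blkOf hcl j b) := by
  simp only [labelMapL, blkOf_blabOf]

/-- the label action on blocks is a bijection -/
theorem labelMapL_bijective (hl : σ.IsAxis l) (j : Fin (ProjectivePlane.order P L)) : Function.Bijective (labelMapL hcl σ hl j) := by
  rw [← Finite.injective_iff_bijective]
  intro b b' h
  apply blkOf_inj_right hcl
  apply σ.onLines.injective
  rw [← blkOf_labelMapL hcl σ hl, ← blkOf_labelMapL hcl σ hl, h]

/-- **The action of `σ` on the labels of block class `j`.** -/
noncomputable def labelPermL (hl : σ.IsAxis l) (j : Fin (ProjectivePlane.order P L)) : Equiv.Perm (Fin (ProjectivePlane.order P L)) :=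
  Equiv.ofBijective (labelMapL hcl σ hl j) (labelMapL_bijective hcl σ hl j)

/-- `blkOf j (labelPermL j b) = σ (blkOf j b)` -/
theorem blkOf_labelPermL (hl : σ.IsAxis l) (j b : Fin (ProjectivePlane.order P L)) :
    blkOf hcl j (labelPermL hcl σ hl j b) = σ.onLines (blkOf hcl j b) := by
  unfold labelPermL; rw [Equiv.ofBijective_apply]; exact blkOf_labelMapL hcl σ hl j b

/-- iterates: `blkOf j ((labelPermL j)^t b) = σ^t (blkOf j b)` -/
theorem blkOf_labelPermL_pow (hl : σ.IsAxis l) (j : Fin (ProjectivePlane.order P L)) (t : ℕ) (b : Fin (ProjectivePlane.order P L)) :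
    blkOf hcl j ((labelPermL hcl σ hl j ^ t) b) = (σ.onLines ^ t) (blkOf hcl j b) := by
  induction t generalizing b with
  | zero => simp
  | succ t ih => rw [pow_succ, Equiv.Perm.mul_apply, ih, blkOf_labelPermL, ← Equiv.Perm.mul_apply, ← pow_succ]

/-- **Incidence is transported** (the label action is a class-fixing automorphism of the affine array). -/
theorem affArr_labelPerm (hl : σ.IsAxis l) (hc : σ.IsCenter c) (i j a : Fin (ProjectivePlane.order P L)) :
    affArr hcl i j (labelPermP hcl σ hl hc i a) = labelPermL hcl σ hl j (affArr hcl i j a) := by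
  rw [affArr_apply_eq_iff hcl, ptOf_labelPermP hcl σ hl hc, blkOf_labelPermL hcl σ hl, σ.mem_iff]
  exact (affArr_apply_eq_iff hcl).1 rfl

/-- the order of the label action divides that of `σ` -/
theorem labelPermP_pow (hl : σ.IsAxis l) (hc : σ.IsCenter c) {q : ℕ} (hq : σ.onPoints ^ q = 1) (i : Fin (ProjectivePlane.order P L)) :
    labelPermP hcl σ hl hc i ^ q = 1 := by
  ext a
  have h := ptOf_labelPermP_pow hcl σ hl hc i q a
  rw [hq, Equiv.Perm.one_apply] at h
  simpa using congrArg Fin.val (ptOf_inj_right hcl h)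

/-- for a non-trivial elation (`c ∈ l`) the label action is fixed-point-free -/
theorem labelPermP_ne (hl : σ.IsAxis l) (hc : σ.IsCenter c) (hne : σ.onPoints ≠ 1) (i a : Fin (ProjectivePlane.order P L)) : labelPermP hcl σ hl hc i a ≠ a := by
  intro h
  have h' := ptOf_labelPermP hcl σ hl hc i a
  rw [h] at h'
  exact σ.moved_of_not_mem_axis hl hc hcl hne (ptOf_not_mem hcl i a) h'.symm

/-- coordinates of the image of a point: same class, label moved by `labelPermP` -/
theorem fP_map (hl : σ.IsAxis l) (hc : σ.IsCenter c) (x : {x : P // x ∉ l}) :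
    fP hcl ⟨σ.onPoints x.1, σ.map_not_mem_axis hl x.2⟩ = ((fP hcl x).1, labelPermP hcl σ hl hc (fP hcl x).1 (fP hcl x).2) := by
  have h := fP_ptOf hcl (fP hcl x).1 (labelPermP hcl σ hl hc (fP hcl x).1 (fP hcl x).2)
  rw [← h]
  congr 1
  apply Subtype.ext
  simp only [ptOf_labelPermP, ptOf_fP]

/-- coordinates of the image of a line: same class, label moved by `labelPermL` -/
theorem fL_map (hl : σ.IsAxis l) (hc : σ.IsCenter c) (m : {m : L // c ∉ m}) :
    fL hcl ⟨σ.onLines m.1, fun h => m.2 (by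
      have h' : σ.onPoints c ∈ σ.onLines m.1 := by rwa [σ.center_fixed hl hc]
      exact (σ.mem_iff c m.1).1 h')⟩ = ((fL hcl m).1, labelPermL hcl σ hl (fL hcl m).1 (fL hcl m).2) := by
  have h := fL_blkOf hcl (fL hcl m).1 (labelPermL hcl σ hl (fL hcl m).1 (fL hcl m).2)
  rw [← h]
  congr 1
  apply Subtype.ext
  simp only [blkOf_labelPermL, blkOf_fL]

end Action

end Summit.Ventures.DiscreteObjects.PP12
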